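import Summits.QuantumFields.YangMills.Theorems.BalabanUVNodesN15TwoSpacingGluingNeumannKnitEntryThree
import HarnessLib

/-!
# THE GLUING STEP AT TWO LATTICE SPACINGS, XLV: ENTRY 3 OF THE COVER's PARAMETRIX ON THE DOUBLED TORUS, TWO GRIDS — `𝔇((Σ∇′*∇′)G₀′, (Σ∇*∇)G₀)` HAS THE RATE `(L^k)^{−1∕16}`,
# FROM THE EXACT PER-CUBE LOCALITY, dag-n15-a's CUT ROWS ∕ DEFECTS AND THE CLOSED IMAGES-TYPE ROW (dag-n15-c g13, FILE 87; N15 = NE2, s1 «background-layer OPERATOR ingredient»)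

Cell `pub-ymgap`, seat `pub-ymgap-dag-n15-c` (R134 (a); HUMAN RULING D-0062), generation 13.  `bears_on: R4∕N15 · K3⁷ SpineGivenEndpointR13SepCoPH (stmt-QuantumFields-20544)`.
Filed `--supports stmt-QuantumFields-20544 --as helper` — COUNT-NEUTRAL.  Theorems only (0 `def`, 0 `sorry`).  Imports BY NAME FILE 86 (through it FILES 83–85, 80, 66–79, 47 and dag-n15-a's
PROGRAMME N); nothing in the tree is modified.

WHAT.  Doubled torus `M = MP (paramsOf d L (m+1) k hL)`, FILE 70's cover, `D₃ = Σ_μ∇*_μ∇_μ = Δ_a − N_L` at the coarse spacing `L^{−k}` and the fine spacing `L^{−(k+r)}`, King's pairing `P`: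
* §1 ★ `commLapDefectConst_le`, ★ `entryThreeDefectConst_le` (compressions to `≤ C·(L^k)^{−1∕16}`); ★★★ `hasMaj_idef_commOp_lapOp_comp_knitG` — the TWO-SIDED two-grid defect of the LOCAL
  commutator row of each cube, `𝔇([D₃′, M_{h′_k}]G′(□_k), [D₃, M_{h_k}]G(□_k)) ≤ 1_□1_□·C_r(L^k)^{−1∕16}·e^{−δd}` (`4 ≤ L^k`): FILE 71 `hasMaj_idef_commOp_lapOp_comp_of_cut` at `W = 0` with
  FILE 74's partition plumbing (FILE 64 ∕ `…FitSecond` fits, FILE 65 cuts), N-IIIb∕c cut rows and N-IIc∕N-IIe∕N-IIh cut defects (FILE 74's local half, now EXPOSED as a theorem);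
* (next file, FILE 88) the weighted-row defect `𝔇(M_{h′}(Σ∇′*∇′)G′(□), M_h(Σ∇*∇)G(□))` and ★★★ `hasMaj_idef_lap_parametrix_knit` (split for the 400-line limit).
FILES 86–88 are the entry-3 rows of FILE 50's `GluedLetters` for the glued `U ≡ 1` family (the `D₃′∘G₀′` majorant and the `𝔇(D₃′G₀′, D₃G₀)` defect).

HONEST FRAMING ∕ LIMITS.  Block-majorant bookkeeping over LANDED rows at `U ≡ 1` on the doubled-cube torus MODEL (Neumann-by-images cubes); no new analytic estimate.  Nothing of
[B5]∕[B6]∕[B9] asserted ([B6] (2.133)–(2.136) p.247 shapes; [B9] Thm 3.14 pp.426–427 the difference template).  NE2⁺ NOT PRINTED, NOT proved; N15 NOT discharged; counts of record UNMOVED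
(typed 28∕28 · discharged 5∕27); one finite 𝕋⁴ at fixed ε per index — NOT infinite volume, NOT OS on ℝ⁴, NOT a mass gap, NOT Clay; R4 closes the conditional finite-𝕋⁴ rung
`BalabanLadder.UV` only.  Restate-immune (no Theses import).
-/

noncomputable section

namespace Summit.QuantumFields.YangMills.BalabanUVNodes.N15.Gluing

open Real
open Literature.MathematicalPhysics.QuantumFieldTheory.Balaban1983to89
open Literature.MathematicalPhysics.QuantumFieldTheory.Balaban1983to89.B5Prop11Plancherel (Tor fine)
open Literature.MathematicalPhysics.QuantumFieldTheory.Balaban1983to89.B11SectG (BlockNorm HasMaj RowSum)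
open Literature.MathematicalPhysics.QuantumFieldTheory.Balaban1983to89.T4EtaRateDefect (idef idef_sub)
open Literature.MathematicalPhysics.QuantumFieldTheory.Balaban1983to89.T4EtaRateCoeffDefect (pull diagK hasMaj_mulOp hasMaj_idef_mulOp diagK_le_decay)
open Literature.MathematicalPhysics.QuantumFieldTheory.Balaban1983to89.B6Prop26Gluing (mulOp mulOp_apply ind ind_nonneg ind_le_one)
open Literature.MathematicalPhysics.QuantumFieldTheory.Balaban1983to89.B6UnitTorusCarrier (unitTorusGeo triangle254_unitTorusGeo rowSum_unitTorusGeo unitTorusGeo_dist_nonneg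
  unitTorusGeo_dist_self)
open Literature.MathematicalPhysics.QuantumFieldTheory.Balaban1983to89.B5SiteBridgeP12 (MP)
open Literature.MathematicalPhysics.QuantumFieldTheory.King1986.Torus (blockOf tdistT tdistT_nonneg)
open Summit.QuantumFields.YangMills.BalabanUVNodes.N15.VectorPiece (bshiftEquiv kingPrV blkFine)
open Summit.QuantumFields.YangMills.BalabanUVNodes.N15.BackgroundLayer (fgrad fgradAdj bgrad symbOp_sD_eq)
open Summit.QuantumFields.YangMills.BalabanUVNodes.N15.TwoGrid (paramsOf deltaOp gOp neumannCubeG chiCube cubeBlocks landauRe qvRe qvAdjRe ineq110_114_pair hasMaj_gOp_of_ineq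
  hasMaj_landauRe hasMaj_chiCube_symOp_comp hasMaj_comp_mulOp_chiInt hasMaj_chiCube_grad_neumannCubeG hasMaj_chiCube_grad_neumannCubeG_fine hasMaj_chiCube_divAdjOut_neumannCubeG_pair
  hasMaj_chiCube_comp_neumannCubeG hasMaj_idef_chiCube_neumannCubeG hasMaj_idef_chiCube_grad_neumannCubeG hasMaj_idef_chiCube_divAdjOut_neumannCubeG)

variable {d : ℕ}

/-! ## §1 Compressions and the local commutator row's two-grid defect -/

section Local

/-- ★ compression of FILE 71's constant at `W = 0`: the partition letters `c₁ = π∕w ≤ π`, `c₂ ≤ 32π²`, the fits `o₁, o₂ ∝ (nw)⁻¹ ≤ ε`, the cut defects `∝ ε`. [folklore] -/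
theorem commLapDefectConst_le (d : ℕ) {w s ε β β₁ mc mm : ℝ} (hw : 1 ≤ w) (hs0 : 0 ≤ s) (hsε : s ≤ ε) (hε : 0 ≤ ε) (hβ : 0 ≤ β) (hβ₁ : 0 ≤ β₁) (hmc : 0 ≤ mc) (hmm : 0 ≤ mm) :
    (d + 1 : ℕ) * (32 * π ^ 2 / w ^ 2 * (mc * ε) + (w⁻¹) ^ 2 * s * (144 * π ^ 3 + 32 * π ^ 3 * (d + 1 : ℕ)) * β +
        2 * (π / w * (mm * ε) + |w⁻¹| * s * (64 * π ^ 2 + π ^ 2 * (d + 1 : ℕ)) * β₁)) + 0 ≤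
      (d + 1 : ℕ) * (32 * π ^ 2 * mc + (144 * π ^ 3 + 32 * π ^ 3 * (d + 1 : ℕ)) * β + 2 * (π * mm + (64 * π ^ 2 + π ^ 2 * (d + 1 : ℕ)) * β₁)) * ε := by
  have hw0 : 0 < w := by linarith
  have hwi : w⁻¹ ≤ 1 := inv_le_one_of_one_le₀ hw
  have hwi0 : 0 ≤ w⁻¹ := by positivity
  have h1 : 32 * π ^ 2 / w ^ 2 * (mc * ε) ≤ 32 * π ^ 2 * mc * ε := by
    have : 32 * π ^ 2 / w ^ 2 ≤ 32 * π ^ 2 := div_le_self (by positivity) (by nlinarith)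
    nlinarith [mul_le_mul_of_nonneg_right this (by positivity : 0 ≤ mc * ε)]
  have h2 : (w⁻¹) ^ 2 * s * (144 * π ^ 3 + 32 * π ^ 3 * (d + 1 : ℕ)) * β ≤ (144 * π ^ 3 + 32 * π ^ 3 * (d + 1 : ℕ)) * β * ε := by
    have t : (w⁻¹) ^ 2 * s ≤ 1 * ε := mul_le_mul (by nlinarith) hsε hs0 zero_le_one
    nlinarith [mul_le_mul_of_nonneg_right t (by positivity : 0 ≤ (144 * π ^ 3 + 32 * π ^ 3 * (d + 1 : ℕ)) * β)]
  have h3 : π / w * (mm * ε) ≤ π * mm * ε := by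
    have : π / w ≤ π := div_le_self Real.pi_pos.le hw
    nlinarith [mul_le_mul_of_nonneg_right this (by positivity : 0 ≤ mm * ε)]
  have h4 : |w⁻¹| * s * (64 * π ^ 2 + π ^ 2 * (d + 1 : ℕ)) * β₁ ≤ (64 * π ^ 2 + π ^ 2 * (d + 1 : ℕ)) * β₁ * ε := by
    rw [abs_of_nonneg hwi0]
    have t : w⁻¹ * s ≤ 1 * ε := mul_le_mul hwi hsε hs0 zero_le_one
    nlinarith [mul_le_mul_of_nonneg_right t (by positivity : 0 ≤ (64 * π ^ 2 + π ^ 2 * (d + 1 : ℕ)) * β₁)]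
  have hD : (0 : ℝ) ≤ (d + 1 : ℕ) := by positivity
  rw [add_zero]
  calc (d + 1 : ℕ) * (32 * π ^ 2 / w ^ 2 * (mc * ε) + (w⁻¹) ^ 2 * s * (144 * π ^ 3 + 32 * π ^ 3 * (d + 1 : ℕ)) * β +
          2 * (π / w * (mm * ε) + |w⁻¹| * s * (64 * π ^ 2 + π ^ 2 * (d + 1 : ℕ)) * β₁))
      ≤ (d + 1 : ℕ) * (32 * π ^ 2 * mc * ε + (144 * π ^ 3 + 32 * π ^ 3 * (d + 1 : ℕ)) * β * ε + 2 * (π * mm * ε + (64 * π ^ 2 + π ^ 2 * (d + 1 : ℕ)) * β₁ * ε)) :=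
        mul_le_mul_of_nonneg_left (by linarith) hD
    _ = _ := by ring

/-- ★ compression of FILE 83's entry-3 defect constant (weighted-row defect `m₃ε`, commutator defect `C_rε`, fit `o ≤ K_oε`). [folklore] -/
theorem entryThreeDefectConst_le {Nov β₃ θ₀ o m₃ Cr ε Ko : ℝ} (hNov : 0 ≤ Nov) (hβ₃ : 0 ≤ β₃) (hθ₀ : 0 ≤ θ₀) (hoK : o ≤ Ko * ε) :
    Nov * ((β₃ * o + m₃ * ε) + (θ₀ * o + Cr * ε)) ≤ Nov * ((β₃ * Ko + m₃) + (θ₀ * Ko + Cr)) * ε := by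
  have h1 : β₃ * o ≤ β₃ * Ko * ε := by nlinarith [mul_le_mul_of_nonneg_left hoK hβ₃]
  have h3 : θ₀ * o ≤ θ₀ * Ko * ε := by nlinarith [mul_le_mul_of_nonneg_left hoK hθ₀]
  calc Nov * ((β₃ * o + m₃ * ε) + (θ₀ * o + Cr * ε))
      ≤ Nov * ((β₃ * Ko * ε + m₃ * ε) + (θ₀ * Ko * ε + Cr * ε)) := mul_le_mul_of_nonneg_left (by linarith) hNov
    _ = _ := by ring

variable {L : ℕ} [NeZero L]

/-- ★★★ **THE TWO-SIDED TWO-GRID η-DEFECT OF THE LOCAL COMMUTATOR ROW OF EACH CUBE OF THE COVER ON THE DOUBLED TORUS**: for odd `L ≥ 3`, `a > 0` there are `δ, C_r > 0` (uniform in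
`m, k, r` and the cube index) with `𝔇([Σ∇′*∇′, M_{h′_k}]G′(□_k), [Σ∇*∇, M_{h_k}]G(□_k)) ≤ 1_□(y)1_□(y′)·C_r(L^k)^{−1∕16}·e^{−δ|y−y′|_T}` for `k ≥ 1`, `4 ≤ L^k` — FILE 71
`hasMaj_idef_commOp_lapOp_comp_of_cut` at `W = 0` with FILE 74's partition plumbing and dag-n15-a's cut rows ∕ defects (FILE 74's local half, exposed).
[cite: Balaban1984PropagatorsII, (2.133)–(2.136) p.247 (shapes + mechanism), (2.36)–(2.37) p.229; Balaban1985BackgroundPropagators, Thm 3.14 pp.426–427 (difference template);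
King1986, Prop. 3.9 (3.73) p.665 (rate shape)] -/
theorem hasMaj_idef_commOp_lapOp_comp_knitG (hL : Odd L ∧ 1 < L) {a : ℝ} (ha : 0 < a) :
    ∃ δ Cr : ℝ, 0 < δ ∧ 0 < Cr ∧ ∀ (m kk r : ℕ) (_hk : 1 ≤ kk) (_hn4 : 4 ≤ L ^ kk) (k : Fin (d + 1) → ZMod (2 * L)),
      HasMaj (BlockNorm.ofBlocks (unitTorusGeo L kk (MP (paramsOf d L (m + 1) kk hL)))
          (fun b : Tor (fine (L ^ kk) (MP (paramsOf d L (m + 1) kk hL))) × Fin (d + 1) => blockOf (L ^ kk) (MP (paramsOf d L (m + 1) kk hL)) b.1))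
        (BlockNorm.ofBlocks (unitTorusGeo L kk (MP (paramsOf d L (m + 1) kk hL)))
          (fun i : Tor (fine (L ^ r * L ^ kk) (MP (paramsOf d L (m + 1) kk hL))) × Fin (d + 1) => blockOf (L ^ r * L ^ kk) (MP (paramsOf d L (m + 1) kk hL)) i.1))
        (idef (pull (kingPrV L kk r (MP (paramsOf d L (m + 1) kk hL)))) (pull (kingPrV L kk r (MP (paramsOf d L (m + 1) kk hL))))
          (commOp (lapOp ((L ^ r * L ^ kk : ℕ) : ℝ) (bshiftEquiv (MP (paramsOf d L (m + 1) kk hL)) (L ^ r * L ^ kk)) 0) (knitH d L m kk (L ^ r * L ^ kk) hL k) ∘ₗ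
            knitG d L m kk (L ^ r * L ^ kk) hL a k)
          (commOp (lapOp ((L ^ kk : ℕ) : ℝ) (bshiftEquiv (MP (paramsOf d L (m + 1) kk hL)) (L ^ kk)) 0) (knitH d L m kk (L ^ kk) hL k) ∘ₗ knitG d L m kk (L ^ kk) hL a k))
        (fun y y' => ind ((cubeBlocks (MP (paramsOf d L (m + 1) kk hL)) (coverCorner (MP (paramsOf d L (m + 1) kk hL)) (L ^ m) L (coverMargin L m) k) (L * L ^ m) : Finset _) : Set _) y *
          ind ((cubeBlocks (MP (paramsOf d L (m + 1) kk hL)) (coverCorner (MP (paramsOf d L (m + 1) kk hL)) (L ^ m) L (coverMargin L m) k) (L * L ^ m) : Finset _) : Set _) y' *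
          (Cr * ((L ^ kk : ℕ) : ℝ) ^ (-(1 / 16 : ℝ)) * Real.exp (-(δ * tdistT (MP (paramsOf d L (m + 1) kk hL)) y y')))) := by
  have hL3 : 3 ≤ L := by obtain ⟨⟨j, hj⟩, h1⟩ := hL; omega
  have hLpos : 0 < L := by omega
  have hL1 : 1 ≤ L := hLpos
  have hLodd : Odd L := hL.1
  have hL2 : 2 ≤ L := hL.2
  obtain ⟨δ₀, C, Cα, Cε, Cαε, hδ₀, hC, H⟩ := ineq110_114_pair (d := d) hL ha
  obtain ⟨δD, βD, hδD, hβD, HD⟩ := hasMaj_chiCube_grad_neumannCubeG (d := d) hL ha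
  obtain ⟨δB, βB, hδB, hβB, HB⟩ := hasMaj_chiCube_divAdjOut_neumannCubeG_pair (d := d) hL ha
  obtain ⟨δc, mc, hδc, hmc, HC⟩ := hasMaj_idef_chiCube_neumannCubeG (d := d) hLodd hL2 ha (γ := 1 / 8) (by norm_num) (by norm_num)
  obtain ⟨δe, me, hδe, hme, HE⟩ := hasMaj_idef_chiCube_grad_neumannCubeG (d := d) hLodd hL2 ha
  obtain ⟨δh, mh, hδh, hmh, HH⟩ := hasMaj_idef_chiCube_divAdjOut_neumannCubeG (d := d) hLodd hL2 ha
  set δ : ℝ := min (min δ₀ (min δD δB)) (min δc (min δe δh)) with hδ_def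
  have hδ : 0 < δ := lt_min (lt_min hδ₀ (lt_min hδD hδB)) (lt_min hδc (lt_min hδe hδh))
  have hd0 : δ ≤ δ₀ := (min_le_left _ _).trans (min_le_left _ _)
  have hdD : δ ≤ δD := (min_le_left _ _).trans ((min_le_right _ _).trans (min_le_left _ _))
  have hdB : δ ≤ δB := (min_le_left _ _).trans ((min_le_right _ _).trans (min_le_right _ _))
  have hdc : δ ≤ δc := (min_le_right _ _).trans (min_le_left _ _)
  have hde : δ ≤ δe := (min_le_right _ _).trans ((min_le_right _ _).trans (min_le_left _ _))
  have hdh : δ ≤ δh := (min_le_right _ _).trans ((min_le_right _ _).trans (min_le_right _ _))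
  set β : ℝ := 2 ^ (d + 1) * (C * Real.exp δ₀) with hβ_def
  have hβ : 0 ≤ β := by positivity
  set β₁ : ℝ := max βD βB with hβ₁_def
  have hβ₁ : 0 ≤ β₁ := hβD.le.trans (le_max_left _ _)
  set mm : ℝ := max me mh with hmm_def
  have hmm : 0 ≤ mm := hme.le.trans (le_max_left _ _)
  set Cr : ℝ := (d + 1 : ℕ) * (32 * π ^ 2 * mc + (144 * π ^ 3 + 32 * π ^ 3 * (d + 1 : ℕ)) * β + 2 * (π * mm + (64 * π ^ 2 + π ^ 2 * (d + 1 : ℕ)) * β₁)) + 1 with hCr_def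
  refine ⟨δ, Cr, hδ, by positivity, fun m kk r hk hn4 k => ?_⟩
  -- the index's data
  set M : Fin (d + 1) → ℕ := MP (paramsOf d L (m + 1) kk hL) with hMdef
  have hM : ∀ ν, M ν = 2 * L * L ^ m := MP_succ_eq L m kk hL
  have hM' : ∀ ν, M ν = 2 * (L * L ^ m) := fun ν => by rw [hM ν, mul_assoc]
  have hw : 0 < L ^ m := pow_pos hLpos m
  have hn : 1 ≤ L ^ kk := Nat.one_le_pow _ _ hLpos
  have hfit := coverMargin_fit hL3 m
  have hfit1 : coverMargin L m + 2 * L ^ m + 1 ≤ L * L ^ m := by omega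
  have hS : L * L ^ m ≤ 2 * L * L ^ m := by rw [mul_assoc]; omega
  have hSe : L ^ (m + 1) = L * L ^ m := by rw [pow_succ, mul_comm]
  have h3 : 3 ≤ L ^ kk * L ^ m :=
    calc 3 ≤ L := hL3
      _ = L ^ 1 := (pow_one L).symm
      _ ≤ L ^ kk := Nat.pow_le_pow_right hLpos hk
      _ = L ^ kk * 1 := (mul_one _).symm
      _ ≤ L ^ kk * L ^ m := Nat.mul_le_mul_left _ hw
  have hwR : (1 : ℝ) ≤ ((L ^ m : ℕ) : ℝ) := by exact_mod_cast hw
  have hnR : (1 : ℝ) ≤ ((L ^ kk : ℕ) : ℝ) := by exact_mod_cast hn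
  set ε : ℝ := ((L ^ kk : ℕ) : ℝ) ^ (-(1 / 16 : ℝ)) with hε_def
  obtain ⟨-, hnwε, -, hε0⟩ := rpow_sixteenth_facts hnR hwR
  have hexp16 : (-((1 : ℝ) / 8 / 2)) = -(1 / 16 : ℝ) := by norm_num
  have hblk : (fun i : Tor (fine (L ^ r * L ^ kk) M) × Fin (d + 1) => blockOf (L ^ r * L ^ kk) M i.1) =
      (fun b : Tor (fine (L ^ kk) M) × Fin (d + 1) => blockOf (L ^ kk) M b.1) ∘ kingPrV L kk r M := (VectorPiece.blkFine_comp_kingPrV (M := M) L kk r).symm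
  set c : Tor M := coverCorner M (L ^ m) L (coverMargin L m) k with hc_def
  have hind : ∀ y y' : Tor M, 0 ≤ ind (g := unitTorusGeo L kk M) ((cubeBlocks M c (L * L ^ m) : Finset (Tor M)) : Set (Tor M)) y *
      ind (g := unitTorusGeo L kk M) ((cubeBlocks M c (L * L ^ m) : Finset (Tor M)) : Set (Tor M)) y' := fun y y' => mul_nonneg (ind_nonneg _ _) (ind_nonneg _ _)
  -- coarse cut rows
  have hG := hasMaj_gOp_of_ineq (L := L) (k := kk) M (L ^ kk) a hn (H (m + 1) kk r hk).1 hC.le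
  have hGc : HasMaj (BlockNorm.ofBlocks (unitTorusGeo L kk M) (fun b : Tor (fine (L ^ kk) M) × Fin (d + 1) => blockOf (L ^ kk) M b.1))
      (BlockNorm.ofBlocks (unitTorusGeo L kk M) (fun b : Tor (fine (L ^ kk) M) × Fin (d + 1) => blockOf (L ^ kk) M b.1)) (mulOp (chiCube M (L ^ kk) c (L * L ^ m)) ∘ₗ knitG d L m kk (L ^ kk) hL a k)
      (fun y y' => ind ((cubeBlocks M c (L * L ^ m) : Finset (Tor M)) : Set (Tor M)) y * ind ((cubeBlocks M c (L * L ^ m) : Finset (Tor M)) : Set (Tor M)) y' * (β * Real.exp (-(δ * tdistT M y y')))) :=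
    hasMaj_rate_le hind hβ hd0 (hasMaj_chiCube_symOp_comp (L := L) (k := kk) (c := c) (S := L * L ^ m) hC.le hδ₀.le hM' (hasMaj_comp_mulOp_chiInt (c := c) (S := L * L ^ m) hC.le hG))
  have hDc : ∀ μ, HasMaj (BlockNorm.ofBlocks (unitTorusGeo L kk M) (fun b : Tor (fine (L ^ kk) M) × Fin (d + 1) => blockOf (L ^ kk) M b.1))
      (BlockNorm.ofBlocks (unitTorusGeo L kk M) (fun b : Tor (fine (L ^ kk) M) × Fin (d + 1) => blockOf (L ^ kk) M b.1))
      (mulOp (chiCube M (L ^ kk) c (L * L ^ m)) ∘ₗ (fgrad ((L ^ kk : ℕ) : ℝ) (bshiftEquiv M (L ^ kk) μ) ∘ₗ knitG d L m kk (L ^ kk) hL a k))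
      (fun y y' => ind ((cubeBlocks M c (L * L ^ m) : Finset (Tor M)) : Set (Tor M)) y * ind ((cubeBlocks M c (L * L ^ m) : Finset (Tor M)) : Set (Tor M)) y' * (β₁ * Real.exp (-(δ * tdistT M y y')))) :=
    fun μ => by
    have h := HD (m + 1) kk hk c μ
    rw [hSe, symbOp_sD_eq] at h
    exact (hasMaj_rate_le hind hβD.le hdD h).mono fun y y' => mul_le_mul_of_nonneg_left (mul_le_mul_of_nonneg_right (le_max_left _ _) (Real.exp_nonneg _)) (hind y y')
  have hDbc : ∀ μ, HasMaj (BlockNorm.ofBlocks (unitTorusGeo L kk M) (fun b : Tor (fine (L ^ kk) M) × Fin (d + 1) => blockOf (L ^ kk) M b.1))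
      (BlockNorm.ofBlocks (unitTorusGeo L kk M) (fun b : Tor (fine (L ^ kk) M) × Fin (d + 1) => blockOf (L ^ kk) M b.1))
      (mulOp (chiCube M (L ^ kk) c (L * L ^ m)) ∘ₗ (bgrad ((L ^ kk : ℕ) : ℝ) (bshiftEquiv M (L ^ kk) μ) ∘ₗ knitG d L m kk (L ^ kk) hL a k))
      (fun y y' => ind ((cubeBlocks M c (L * L ^ m) : Finset (Tor M)) : Set (Tor M)) y * ind ((cubeBlocks M c (L * L ^ m) : Finset (Tor M)) : Set (Tor M)) y' * (β₁ * Real.exp (-(δ * tdistT M y y')))) :=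
    fun μ => by
    have h := (HB (m + 1) kk r hk c μ).1
    rw [hSe] at h
    rw [bgrad_eq_neg_symbOp, LinearMap.neg_comp, LinearMap.comp_neg]
    exact ((hasMaj_rate_le hind hβB.le hdB h).mono fun y y' => mul_le_mul_of_nonneg_left (mul_le_mul_of_nonneg_right (le_max_right _ _) (Real.exp_nonneg _)) (hind y y')).neg
  -- cut defects (N-IIc, N-IIe, N-IIh), two-sided, fine blocks through the pairing
  have hIGc : HasMaj (BlockNorm.ofBlocks (unitTorusGeo L kk M) (fun b : Tor (fine (L ^ kk) M) × Fin (d + 1) => blockOf (L ^ kk) M b.1))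
      (BlockNorm.ofBlocks (unitTorusGeo L kk M) ((fun b : Tor (fine (L ^ kk) M) × Fin (d + 1) => blockOf (L ^ kk) M b.1) ∘ kingPrV L kk r M))
      (idef (pull (kingPrV L kk r M)) (pull (kingPrV L kk r M)) (mulOp (chiCube M (L ^ r * L ^ kk) c (L * L ^ m)) ∘ₗ knitG d L m kk (L ^ r * L ^ kk) hL a k)
        (mulOp (chiCube M (L ^ kk) c (L * L ^ m)) ∘ₗ knitG d L m kk (L ^ kk) hL a k))
      (fun y y' => ind ((cubeBlocks M c (L * L ^ m) : Finset (Tor M)) : Set (Tor M)) y * ind ((cubeBlocks M c (L * L ^ m) : Finset (Tor M)) : Set (Tor M)) y' * (mc * ε * Real.exp (-(δ * tdistT M y y')))) := by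
    have h := HC (m + 1) kk r hk hL c
    rw [hSe, hexp16] at h
    have h2 := hasMaj_rate_le hind (by positivity : 0 ≤ mc * ε) hdc h
    rw [hblk] at h2
    exact h2
  have hIDc : ∀ μ, HasMaj (BlockNorm.ofBlocks (unitTorusGeo L kk M) (fun b : Tor (fine (L ^ kk) M) × Fin (d + 1) => blockOf (L ^ kk) M b.1))
      (BlockNorm.ofBlocks (unitTorusGeo L kk M) ((fun b : Tor (fine (L ^ kk) M) × Fin (d + 1) => blockOf (L ^ kk) M b.1) ∘ kingPrV L kk r M))
      (idef (pull (kingPrV L kk r M)) (pull (kingPrV L kk r M))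
        (mulOp (chiCube M (L ^ r * L ^ kk) c (L * L ^ m)) ∘ₗ (fgrad ((L ^ r * L ^ kk : ℕ) : ℝ) (bshiftEquiv M (L ^ r * L ^ kk) μ) ∘ₗ knitG d L m kk (L ^ r * L ^ kk) hL a k))
        (mulOp (chiCube M (L ^ kk) c (L * L ^ m)) ∘ₗ (fgrad ((L ^ kk : ℕ) : ℝ) (bshiftEquiv M (L ^ kk) μ) ∘ₗ knitG d L m kk (L ^ kk) hL a k)))
      (fun y y' => ind ((cubeBlocks M c (L * L ^ m) : Finset (Tor M)) : Set (Tor M)) y * ind ((cubeBlocks M c (L * L ^ m) : Finset (Tor M)) : Set (Tor M)) y' * (mm * ε * Real.exp (-(δ * tdistT M y y')))) :=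
    fun μ => by
    have h := HE (m + 1) kk r hk hn4 hL c μ
    rw [hSe, symbOp_sD_eq, symbOp_sD_eq] at h
    have h2 := (hasMaj_rate_le hind (by positivity : 0 ≤ me * ε) hde h).mono fun y y' =>
      mul_le_mul_of_nonneg_left (mul_le_mul_of_nonneg_right (mul_le_mul_of_nonneg_right (le_max_left me mh) hε0) (Real.exp_nonneg _)) (hind y y')
    rw [hblk] at h2
    exact h2
  have hIDbc : ∀ μ, HasMaj (BlockNorm.ofBlocks (unitTorusGeo L kk M) (fun b : Tor (fine (L ^ kk) M) × Fin (d + 1) => blockOf (L ^ kk) M b.1))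
      (BlockNorm.ofBlocks (unitTorusGeo L kk M) ((fun b : Tor (fine (L ^ kk) M) × Fin (d + 1) => blockOf (L ^ kk) M b.1) ∘ kingPrV L kk r M))
      (idef (pull (kingPrV L kk r M)) (pull (kingPrV L kk r M))
        (mulOp (chiCube M (L ^ r * L ^ kk) c (L * L ^ m)) ∘ₗ (bgrad ((L ^ r * L ^ kk : ℕ) : ℝ) (bshiftEquiv M (L ^ r * L ^ kk) μ) ∘ₗ knitG d L m kk (L ^ r * L ^ kk) hL a k))
        (mulOp (chiCube M (L ^ kk) c (L * L ^ m)) ∘ₗ (bgrad ((L ^ kk : ℕ) : ℝ) (bshiftEquiv M (L ^ kk) μ) ∘ₗ knitG d L m kk (L ^ kk) hL a k)))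
      (fun y y' => ind ((cubeBlocks M c (L * L ^ m) : Finset (Tor M)) : Set (Tor M)) y * ind ((cubeBlocks M c (L * L ^ m) : Finset (Tor M)) : Set (Tor M)) y' * (mm * ε * Real.exp (-(δ * tdistT M y y')))) :=
    fun μ => by
    have h := HH (m + 1) kk r hk hn4 hL c μ
    rw [hSe] at h
    rw [bgrad_eq_neg_symbOp, bgrad_eq_neg_symbOp, LinearMap.neg_comp, LinearMap.comp_neg, LinearMap.neg_comp, LinearMap.comp_neg, idef_neg]
    have h2 := (hasMaj_rate_le hind (by positivity : 0 ≤ mh * ε) hdh h).mono fun y y' =>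
      mul_le_mul_of_nonneg_left (mul_le_mul_of_nonneg_right (mul_le_mul_of_nonneg_right (le_max_right me mh) hε0) (Real.exp_nonneg _)) (hind y y')
    rw [hblk] at h2
    exact h2.neg
  -- the partition's plumbing (FILE 74)
  obtain ⟨hs0, hs13, hs1', hs1, hsL, hnκ, hnκ'⟩ := coverFit_params (L := L) (kk := kk) (r := r) (w := L ^ m) hL1 hw h3
  have hχ := fun μ => chiCube_coverCorner_eq_one_side (M := M) (n := L ^ kk) (m₀ := coverMargin L m) hM hw hfit1 hS μ k
  have hχ' := fun μ => chiCube_coverCorner_eq_one_side (M := M) (n := L ^ r * L ^ kk) (m₀ := coverMargin L m) hM hw hfit1 hS μ k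
  have hξ := fun μ ν b => coverXi_shift (n := L ^ kk) hM hw μ ν b
  have hξ' := fun μ ν b => coverXi_shift (n := L ^ r * L ^ kk) hM hw μ ν b
  have hoff := fun ν x' => coverXi_offset (M := M) (L := L) (kk := kk) (r := r) (w := L ^ m) (q := L) ν x'
  have hK2 : 2 ≤ 2 * L := by omega
  have hLr : 1 ≤ L ^ r := Nat.one_le_pow _ _ hL1
  -- FILE 71 at `W = 0`
  have key := hasMaj_idef_commOp_lapOp_comp_of_cut (g := unitTorusGeo L kk M) (fun b : Tor (fine (L ^ kk) M) × Fin (d + 1) => blockOf (L ^ kk) M b.1) (kingPrV L kk r M)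
    (J := Fin (d + 1)) (e := bshiftEquiv M (L ^ kk)) (e' := bshiftEquiv M (L ^ r * L ^ kk)) (n := ((L ^ kk : ℕ) : ℝ)) (n' := ((L ^ r * L ^ kk : ℕ) : ℝ))
    (W := (0 : (Tor (fine (L ^ kk) M) × Fin (d + 1) → ℝ) →ₗ[ℝ] (Tor (fine (L ^ kk) M) × Fin (d + 1) → ℝ)))
    (W' := (0 : (Tor (fine (L ^ r * L ^ kk) M) × Fin (d + 1) → ℝ) →ₗ[ℝ] (Tor (fine (L ^ r * L ^ kk) M) × Fin (d + 1) → ℝ)))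
    (N := knitG d L m kk (L ^ kk) hL a k) (N' := knitG d L m kk (L ^ r * L ^ kk) hL a k) (h := knitH d L m kk (L ^ kk) hL k) (h' := knitH d L m kk (L ^ r * L ^ kk) hL k)
    (by positivity : (0 : ℝ) ≤ π / ((L ^ m : ℕ) : ℝ)) (by positivity : (0 : ℝ) ≤ 32 * π ^ 2 / (((L ^ m : ℕ) : ℝ)) ^ 2)
    (by positivity : (0 : ℝ) ≤ |((((L ^ m : ℕ) : ℝ)))⁻¹| * (((L ^ kk : ℕ) : ℝ) * ((L ^ m : ℕ) : ℝ))⁻¹ * (64 * π ^ 2 + π ^ 2 * Fintype.card (Fin (d + 1))))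
    (by positivity : (0 : ℝ) ≤ ((((L ^ m : ℕ) : ℝ)))⁻¹ ^ 2 * (((L ^ kk : ℕ) : ℝ) * ((L ^ m : ℕ) : ℝ))⁻¹ * (144 * π ^ 3 + 32 * π ^ 3 * Fintype.card (Fin (d + 1))))
    (fun μ x' => abs_fgrad_coverH_le hM hw k μ x') (fun μ x' => abs_bgrad_coverH_le hM hw k μ x') (fun μ x' => abs_fgradAdj_fgrad_coverH_le hM hw k μ x')
    (fun μ x' => abs_fgrad_hcube_two_grid_le (2 * L) (coverXi M (L ^ kk) (L ^ m)) (coverXi M (L ^ r * L ^ kk) (L ^ m)) (kingPrV L kk r M) (bshiftEquiv M (L ^ kk))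
      (bshiftEquiv M (L ^ r * L ^ kk)) hK2 hLr hs0 hs1' hsL hnκ hnκ' hξ hξ' hoff k μ x')
    (fun μ x' => abs_bgrad_hcube_two_grid_le (2 * L) (coverXi M (L ^ kk) (L ^ m)) (coverXi M (L ^ r * L ^ kk) (L ^ m)) (kingPrV L kk r M) (bshiftEquiv M (L ^ kk))
      (bshiftEquiv M (L ^ r * L ^ kk)) hK2 hLr hs0 hs1' hsL hnκ hnκ' hξ hξ' hoff k μ x')
    (fun μ x' => abs_fgradAdj_fgrad_hcube_two_grid_le (2 * L) (coverXi M (L ^ kk) (L ^ m)) (coverXi M (L ^ r * L ^ kk) (L ^ m)) (kingPrV L kk r M) (bshiftEquiv M (L ^ kk))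
      (bshiftEquiv M (L ^ r * L ^ kk)) hK2 hLr hs0 hs13 hs1 hsL hnκ hnκ' hξ hξ' hoff k μ x')
    (fun μ => fgradAdj_fgrad_hcube_cut (2 * L) (coverXi M (L ^ kk) (L ^ m)) (bshiftEquiv M (L ^ kk)) μ _ (hχ μ))
    (fun μ => fgrad_hcube_cut (2 * L) (coverXi M (L ^ kk) (L ^ m)) (bshiftEquiv M (L ^ kk)) μ _ (hχ μ))
    (fun μ => bgrad_hcube_cut (2 * L) (coverXi M (L ^ kk) (L ^ m)) (bshiftEquiv M (L ^ kk)) μ _ (hχ μ))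
    (fun μ => fgradAdj_fgrad_hcube_cut (2 * L) (coverXi M (L ^ r * L ^ kk) (L ^ m)) (bshiftEquiv M (L ^ r * L ^ kk)) μ _ (hχ' μ))
    (fun μ => fgrad_hcube_cut (2 * L) (coverXi M (L ^ r * L ^ kk) (L ^ m)) (bshiftEquiv M (L ^ r * L ^ kk)) μ _ (hχ' μ))
    (fun μ => bgrad_hcube_cut (2 * L) (coverXi M (L ^ r * L ^ kk) (L ^ m)) (bshiftEquiv M (L ^ r * L ^ kk)) μ _ (hχ' μ))
    hGc hDc hDbc hIGc hIDc hIDbc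
    (hasMaj_idef_commOp_zero (g := unitTorusGeo L kk M) (fun b : Tor (fine (L ^ kk) M) × Fin (d + 1) => blockOf (L ^ kk) M b.1) (kingPrV L kk r M) _ _ _ _ _ δ)
  rw [← hblk] at key
  refine key.mono fun y y' => mul_le_mul_of_nonneg_left (mul_le_mul_of_nonneg_right ?_ (Real.exp_nonneg _)) (hind y y')
  -- the compression
  clear key hIDbc hIDc hIGc hDbc hDc hGc hG hξ hξ' hoff hχ hχ' H HD HB HC HE HH hblk hind
  rw [Fintype.card_fin]
  have hs_eq : (((L ^ kk : ℕ) : ℝ) * ((L ^ m : ℕ) : ℝ))⁻¹ ≤ ε := hnwε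
  have hcomp := commLapDefectConst_le d (β := β) (β₁ := β₁) (mc := mc) (mm := mm) hwR (by positivity) hs_eq hε0 hβ hβ₁ hmc.le hmm
  refine hcomp.trans ?_
  rw [hCr_def, add_mul _ (1 : ℝ) ε, one_mul]
  exact le_add_of_nonneg_right hε0

end Local

end Summit.QuantumFields.YangMills.BalabanUVNodes.N15.Gluing

end
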